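import Summits.QuantumFields.YangMills.Theorems.UnitScaleTiltProp7CentrePinnedHessianPoincare
import Summits.QuantumFields.YangMills.Theorems.UnitScaleTiltProp7CentreHarmonicInterpKernel
import HarnessLib

/-!
# Route `UnitScaleTilt`, crux K1 «MinimiserStabilityRegPr» (stmt-QuantumFields-19200), route-R E′ path (α′), row (E1-a) of LOCATE-E1-CONTRACTION: UNIQUENESS OF THE PINNED BIHARMONIC
# INTERPOLANT (flat, `Site (F.P K) 0`) — a site function vanishing on the `k`-centres with `Δ²χ = 0` off the centres is identically zero; hence two pinned interpolants of the same centre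
# data that are both biharmonic off the centres coincide, and the kernel of the exact corrector's linearisation is trivial (the fixed-point form `R(ψ) = 0 ⟺ ψ = LinCorr(D‴ + N(ψ))`)

Cell `ym3-torus`, D-0154 (3c) twin-width seat `ym-routeR-w3` (gen 5); ★p1 g15 20:35:45Z «routeR-w3: (E1) LOCATE — GO» → LOCATE `ym-routeR-w3/LOCATE-E1-CONTRACTION-routeRw3g5.md` §1∕§5 (E1-a).
THEOREMS ONLY (0 `def`, 0 `sorry`); `--supports stmt-QuantumFields-19200`, count-neutral.  YM₃ on T³ is a ladder rung (R3), not the Clay problem; nothing here claims the stub, the crux,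
d = 4 or the gap.  PROOF: `Σ_x(Δχ)² = Σ_xχ·(Δ²χ)` (✓ `…InterpKernel.sum_smul_laplace_comm`, Δ symmetric) `= Σ_{x∈C}0·(Δ²χ) + Σ_{x∉C}χ·0 = 0`, then the centre-pinned Hessian Poincaré
✓ `Prop7CentrePinnedHessianPoincare.sum_sq_le_laplace_sq_of_vanish_on_range` ((D1-glob), routeR-w2 g5): `Σχ² ≤ C_P·ℓ⁴·Σ(Δχ)² = 0`.

WHAT IS PROVED (ns `…Theorems.Prop7PinnedBiharmonicUniqueness`; `P.d = 3`, `k ≤ P.m + P.K`, `c ≠ 0`, `C = Set.range (embIter k)`).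
* `sum_laplace_sq_eq_sum_mul_bilaplace` (`Σ(Δχ)² = Σχ·Δ²χ`, any `P`), ★★★ `eq_zero_of_vanish_centres_of_bilaplace_off` (χ = 0), ★★ `interpolant_unique` (two pinned biharmonic interpolants of
  the same data agree), ★ `eq_of_sub_pinned_biharmonic` (the corrector form: `ψ − ψ′` pinned and biharmonic off `C` ⇒ `ψ = ψ′`).
HONEST SCOPE.  Flat, scalar; the covariant version (`Δ_W`) is flat + O(e) (P-cov2) and is NOT here.

References: T. Bałaban, CMP 99 (1985) 75–102 [Balaban1985RegularSpaces] ((1.14) p.78); CMP 102 (1985) 277–309 [Balaban1985Variational] (Prop. 7 p.299).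
-/

set_option autoImplicit false

noncomputable section

open scoped BigOperators

namespace Summit.QuantumFields.YangMills.Theorems.Prop7PinnedBiharmonicUniqueness

open Literature.MathematicalPhysics.QuantumFieldTheory.Balaban1983to89
open LatticeFieldCalculus
open B15DeterminingSets (embIter)
open Summit.QuantumFields.YangMills.Theorems.Prop7CentrePinnedHessianPoincare (sum_sq_le_laplace_sq_of_vanish_on_range)
open Summit.QuantumFields.YangMills.Theorems.Prop7CentreHarmonicInterpKernel (sum_smul_laplace_comm laplace_sub')

variable {P : Params}

/-- `Σ_x (Δχ)(x)² = Σ_x χ(x)·(Δ²χ)(x)` (Δ symmetric). [folklore] -/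
theorem sum_laplace_sq_eq_sum_mul_bilaplace {j : ℕ} (c : ℝ) (χ : SiteField P j ℝ) :
    ∑ x : Site P j, (laplace c χ x) ^ 2 = ∑ x : Site P j, χ x * laplace c (laplace c χ) x := by
  have h := sum_smul_laplace_comm (V := ℝ) c χ (laplace c χ)
  simp only [smul_eq_mul] at h
  rw [h]
  refine Finset.sum_congr rfl fun x _ => ?_
  ring

/-- ★★★ **A PINNED FUNCTION THAT IS BIHARMONIC OFF THE CENTRES VANISHES** (`d = 3`, `C = range (embIter k)`, `c ≠ 0`): `χ|_C = 0 ∧ (Δ²χ = 0 off C) ⇒ χ = 0`.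
[cite: Balaban1985RegularSpaces, (1.14) p.78] -/
theorem eq_zero_of_vanish_centres_of_bilaplace_off (hd : P.d = 3) {k : ℕ} (hk : k ≤ P.m + P.K) {c : ℝ} (hc : c ≠ 0) (χ : SiteField P 0 ℝ)
    (h0 : ∀ y ∈ Set.range (embIter k), χ y = 0) (hEL : ∀ x ∉ Set.range (embIter k), laplace c (laplace c χ) x = 0) : χ = 0 := by
  classical
  -- `Σ(Δχ)² = Σ χ·Δ²χ = 0`
  have h1 : ∑ x : Site P 0, (laplace c χ x) ^ 2 = 0 := by
    rw [sum_laplace_sq_eq_sum_mul_bilaplace]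
    refine Finset.sum_eq_zero fun x _ => ?_
    by_cases hx : x ∈ Set.range (embIter k)
    · rw [h0 x hx, zero_mul]
    · rw [hEL x hx, mul_zero]
  -- the pinned Hessian Poincaré
  have h2 := sum_sq_le_laplace_sq_of_vanish_on_range hd hk hc χ h0
  rw [h1, mul_zero] at h2
  have h3 : ∑ x : Site P 0, (χ x) ^ 2 = 0 := le_antisymm h2 (Finset.sum_nonneg fun x _ => sq_nonneg _)
  funext x
  have := (Finset.sum_eq_zero_iff_of_nonneg fun y _ => sq_nonneg (χ y)).mp h3 x (Finset.mem_univ x)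
  exact pow_eq_zero_iff (n := 2) (by norm_num) |>.mp this

/-- ★★ **UNIQUENESS OF THE PINNED BIHARMONIC INTERPOLANT**: two site functions with the same values on the centres, both biharmonic off the centres, coincide. [cite: Balaban1985RegularSpaces, (1.14) p.78] -/
theorem interpolant_unique (hd : P.d = 3) {k : ℕ} (hk : k ≤ P.m + P.K) {c : ℝ} (hc : c ≠ 0) (u u' : SiteField P 0 ℝ)
    (hC : ∀ y ∈ Set.range (embIter k), u y = u' y)
    (hu : ∀ x ∉ Set.range (embIter k), laplace c (laplace c u) x = 0) (hu' : ∀ x ∉ Set.range (embIter k), laplace c (laplace c u') x = 0) : u = u' := by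
  have h := eq_zero_of_vanish_centres_of_bilaplace_off hd hk hc (fun x => u x - u' x)
    (fun y hy => by simp [hC y hy]) (fun x hx => by
      rw [laplace_sub', laplace_sub']
      simp [hu x hx, hu' x hx])
  funext x
  have := congrFun h x
  simp only [Pi.zero_apply, sub_eq_zero] at this
  exact this

/-- ★ **THE CORRECTOR FORM** (LOCATE-E1 §1): if `ψ − ψ′` vanishes on the centres and is biharmonic off them, then `ψ = ψ′` — the step turning «`D − D_Wψ ∈ S_H` with `ψ` pinned» into the
fixed-point equation `ψ = LinCorr(D‴ + N(ψ))` (flat reading). [cite: Balaban1985Variational, Prop. 7 p.299] -/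
theorem eq_of_sub_pinned_biharmonic (hd : P.d = 3) {k : ℕ} (hk : k ≤ P.m + P.K) {c : ℝ} (hc : c ≠ 0) (ψ ψ' : SiteField P 0 ℝ)
    (hC : ∀ y ∈ Set.range (embIter k), ψ y - ψ' y = 0)
    (hEL : ∀ x ∉ Set.range (embIter k), laplace c (laplace c (fun z => ψ z - ψ' z)) x = 0) : ψ = ψ' := by
  have h := eq_zero_of_vanish_centres_of_bilaplace_off hd hk hc (fun z => ψ z - ψ' z) hC hEL
  funext x
  have := congrFun h x
  simp only [Pi.zero_apply, sub_eq_zero] at this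
  exact this

end Summit.QuantumFields.YangMills.Theorems.Prop7PinnedBiharmonicUniqueness
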